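import Mathlib
import HarnessLib
import Literature.NumberTheory.Transcendental.KZProductIdeal
import Summits.KontsevichZagierPeriods.KontsevichZagierPeriods.Theorems.LinRedNormalFormDihedralNormalFormStubNestedReductionAux8

/-!
# `DihedralNormalForm`, line `torus-descent-sum-shadow`, stub `stub_nestedReduction` — Aux 16

Support file for the stub `stub_nestedReduction` (THEOREM N) of the crux `DihedralNormalForm`
(stmt-KontsevichZagierPeriods-3912, route `LinRedNormalForm`): **a nested atom is a prefix-nested
atom after a coordinate permutation** (`Nested.exists_prefix_reindex`).  Order the coordinates by
decreasing DEPTH (number of active kernel chords through them; `Tuple.sort`): since the active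
kernel chords of a nested atom form a chain, a coordinate at least as deep as a point of a chord
lies in that chord (`Nested.mem_of_depth_le`), so every active kernel chord becomes a PREFIX
`[0, j − i]` in the sorted coordinates, singletons stay singletons, and the chord pushforward
(Aux 8) writes the relabelled integrand as an atom whose active kernel chords all start at `0`.
The relabelling is one change-of-variables move (`KZ.of_sub_of_reindex_mem_relations`).

References: M. Kontsevich, D. Zagier, *Periods* (2001), §1.2, rule (2).
-/

noncomputable section

open MeasureTheory Set

namespace Summit.KontsevichZagierPeriods.DihedralNormalForm.TorusDescent

open Literature.NumberTheory.Transcendental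

namespace Nested

variable {k : ℕ}

/-! ## Depth in a chain of intervals -/

/-- The active kernel chords. -/
def kern (e : Fin k → Fin k → ℤ) : Finset (Fin k × Fin k) :=
  Finset.univ.filter fun ij => ij.1 < ij.2 ∧ e ij.1 ij.2 ≠ 0

/-- The depth of a coordinate: the number of active kernel chords through it. -/
def depth (e : Fin k → Fin k → ℤ) (l : Fin k) : ℕ :=
  ((kern e).filter fun ij => ij.1 ≤ l ∧ l ≤ ij.2).card

/-- **In a chain of intervals, depth decides membership**: if `l ∈ [i,j]` (an active kernel
chord) and `depth l' ≥ depth l`, then `l' ∈ [i,j]`. -/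
theorem mem_of_depth_le {e : Fin k → Fin k → ℤ}
    (hN : ∀ i j i' j' : Fin k, i < j → i' < j' → e i j ≠ 0 → e i' j' ≠ 0 →
      (i ≤ i' ∧ j' ≤ j) ∨ (i' ≤ i ∧ j ≤ j'))
    {ij : Fin k × Fin k} (hij : ij ∈ kern e) {l l' : Fin k} (hl : ij.1 ≤ l ∧ l ≤ ij.2)
    (hd : depth e l ≤ depth e l') : ij.1 ≤ l' ∧ l' ≤ ij.2 := by
  by_contra hl'
  simp only [kern, Finset.mem_filter, Finset.mem_univ, true_and] at hij
  -- every chord through `l'` passes through `l`, and `ij` does not pass through `l'`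
  have hsub : (kern e).filter (fun x => x.1 ≤ l' ∧ l' ≤ x.2) ⊂
      (kern e).filter (fun x => x.1 ≤ l ∧ l ≤ x.2) := by
    rw [Finset.ssubset_iff_of_subset]
    · exact ⟨ij, Finset.mem_filter.mpr ⟨Finset.mem_filter.mpr ⟨Finset.mem_univ _, hij⟩, hl⟩,
        fun h => hl' (Finset.mem_filter.mp h).2⟩
    · intro x hx
      simp only [kern, Finset.mem_filter, Finset.mem_univ, true_and] at hx ⊢
      refine ⟨hx.1, ?_⟩
      rcases hN _ _ _ _ hx.1.1 hij.1 hx.1.2 hij.2 with h | h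
      · -- `ij ⊆ x`
        exact ⟨h.1.trans hl.1, hl.2.trans h.2⟩
      · -- `x ⊆ ij`: then `l' ∈ x ⊆ ij`, contradiction
        exact absurd ⟨h.1.trans hx.2.1, hx.2.2.trans h.2⟩ hl'
  exact absurd (Finset.card_lt_card hsub) (not_lt.mpr hd)

/-- A non-empty down-set of `Fin k` is an initial interval. -/
theorem exists_eq_Icc_of_downset {D : Finset (Fin k)} (hne : D.Nonempty)
    (hdown : ∀ m ∈ D, ∀ m' ≤ m, m' ∈ D) :
    ∃ z j' : Fin k, (z : ℕ) = 0 ∧ z ≤ j' ∧ D = Finset.Icc z j' := by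
  obtain ⟨m₀, hm₀⟩ := hne
  have hk : 0 < k := Fin.pos m₀
  refine ⟨⟨0, hk⟩, D.max' ⟨m₀, hm₀⟩, rfl, Fin.mk_le_of_le_val (Nat.zero_le _), ?_⟩
  ext m
  rw [Finset.mem_Icc]
  constructor
  · exact fun hm => ⟨Fin.mk_le_of_le_val (Nat.zero_le _), D.le_max' m hm⟩
  · exact fun hm => hdown _ (D.max'_mem _) m hm.2

/-! ## The sorted coordinates -/

/-- The permutation listing the coordinates by decreasing depth. -/
def dsort (e : Fin k → Fin k → ℤ) : Equiv.Perm (Fin k) :=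
  Tuple.sort fun l => OrderDual.toDual (depth e l)

/-- Depth is antitone along the sorted coordinates. -/
theorem depth_dsort_antitone (e : Fin k → Fin k → ℤ) {m m' : Fin k} (h : m ≤ m') :
    depth e (dsort e m') ≤ depth e (dsort e m) := by
  have := Tuple.monotone_sort (fun l => OrderDual.toDual (depth e l)) h
  exact this

/-- The positions of a chord in the sorted coordinates. -/
def pos (e : Fin k → Fin k → ℤ) (ij : Fin k × Fin k) : Finset (Fin k) :=
  Finset.univ.filter fun m => ij.1 ≤ dsort e m ∧ dsort e m ≤ ij.2

/-- **Active kernel chords occupy initial intervals of positions.** -/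
theorem pos_kern_eq_Icc {e : Fin k → Fin k → ℤ}
    (hN : ∀ i j i' j' : Fin k, i < j → i' < j' → e i j ≠ 0 → e i' j' ≠ 0 →
      (i ≤ i' ∧ j' ≤ j) ∨ (i' ≤ i ∧ j ≤ j'))
    {ij : Fin k × Fin k} (hij : ij ∈ kern e) :
    ∃ z j' : Fin k, (z : ℕ) = 0 ∧ z ≤ j' ∧ pos e ij = Finset.Icc z j' := by
  refine exists_eq_Icc_of_downset ⟨(dsort e).symm ij.1, ?_⟩ fun m hm m' hm' => ?_
  · have h := (Finset.mem_filter.mp hij).2.1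
    simp [pos, h.le]
  · simp only [pos, Finset.mem_filter, Finset.mem_univ, true_and] at hm ⊢
    exact mem_of_depth_le hN hij hm (depth_dsort_antitone e hm')

/-- Singletons occupy singletons. -/
theorem pos_diag (e : Fin k → Fin k → ℤ) (l : Fin k) :
    pos e (l, l) = Finset.Icc ((dsort e).symm l) ((dsort e).symm l) := by
  ext m
  simp only [pos, Finset.mem_filter, Finset.mem_univ, true_and, Finset.mem_Icc]
  constructor
  · rintro ⟨h1, h2⟩
    have : dsort e m = l := le_antisymm h2 h1
    rw [← this, Equiv.symm_apply_apply]
    exact ⟨le_rfl, le_rfl⟩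
  · rintro ⟨h1, h2⟩
    have : m = (dsort e).symm l := le_antisymm h2 h1
    rw [this, Equiv.apply_symm_apply]
    exact ⟨le_rfl, le_rfl⟩

/-! ## The relabelled atom -/

/-- Reading a vector through the inverse sorting permutation: chord products become products over
positions. -/
theorem cp_comp_dsort_symm (e : Fin k → Fin k → ℤ) (i j : Fin k) (w : Fin k → ℝ) :
    (∏ l : Fin k, if i ≤ l ∧ l ≤ j then w ((dsort e).symm l) else 1) = ∏ m ∈ pos e (i, j), w m := by
  rw [pos, Finset.prod_filter]
  exact (Equiv.prod_comp (dsort e) (fun l => if i ≤ l ∧ l ≤ j then w ((dsort e).symm l) else 1)).symm.trans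
    (Finset.prod_congr rfl fun m _ => by simp)

/-- **A nested atom is a prefix-nested atom after relabelling the coordinates by depth.** -/
theorem exists_prefix_reindex (q : ℚ) (a : Fin k → ℕ) (e : Fin k → Fin k → ℤ)
    (hN : ∀ i j i' j' : Fin k, i < j → i' < j' → e i j ≠ 0 → e i' j' ≠ 0 →
      (i ≤ i' ∧ j' ≤ j) ∨ (i' ≤ i ∧ j ≤ j'))
    (s : KZ.IntegralRep k) (hs : s.domain = ocube k) (hi : EqOn s.integrand (atomQ k q a e) s.domain) :
    ∃ (a' : Fin k → ℕ) (e' : Fin k → Fin k → ℤ) (s' : KZ.IntegralRep k),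
      (∀ i j : Fin k, i < j → e' i j ≠ 0 → (i : ℕ) = 0) ∧ s'.domain = ocube k ∧
      EqOn s'.integrand (atomQ k q a' e') s'.domain ∧ KZ.of s - KZ.of s' ∈ KZ.relations := by
  classical
  -- the active chords (kernel and singletons) and their exponents pushed to positions
  set src : Finset (Fin k × Fin k) := Finset.univ.filter fun ij => ij.1 ≤ ij.2 ∧ e ij.1 ij.2 ≠ 0
    with hsrc
  have hS : ∀ ij ∈ src, ∃ i' j' : Fin k, i' ≤ j' ∧ pos e ij = Finset.Icc i' j' := by
    intro ij hij
    simp only [hsrc, Finset.mem_filter, Finset.mem_univ, true_and] at hij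
    rcases eq_or_lt_of_le hij.1 with heq | hlt
    · refine ⟨(dsort e).symm ij.1, (dsort e).symm ij.1, le_rfl, ?_⟩
      have : ij = (ij.1, ij.1) := Prod.ext rfl heq.symm
      rw [this]
      exact pos_diag e ij.1
    · obtain ⟨z, j', -, hzj, h⟩ := pos_kern_eq_Icc hN (Finset.mem_filter.mpr ⟨Finset.mem_univ _, hlt, hij.2⟩)
      exact ⟨z, j', hzj, h⟩
  set e' : Fin k → Fin k → ℤ := fun i' j' =>
    ∑ ij ∈ src.filter (fun ij => pos e ij = Finset.Icc i' j'), e ij.1 ij.2 with he'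
  set s' := s.reindex (dsort e).symm with hs'
  refine ⟨fun m => a (dsort e m), e', s', fun i' j' hij' hne => ?_, ?_, fun w hw => ?_,
    KZ.of_sub_of_reindex_mem_relations s (dsort e).symm⟩
  · -- prefix-nestedness of the pushed exponents
    obtain ⟨ij, hij, -⟩ := Finset.exists_ne_zero_of_sum_ne_zero hne
    rw [Finset.mem_filter] at hij
    have hij1 := hij.1
    simp only [hsrc, Finset.mem_filter, Finset.mem_univ, true_and] at hij1
    rcases eq_or_lt_of_le hij1.1 with heq | hlt
    · -- a singleton cannot occupy two positions
      have h1 : pos e ij = Finset.Icc ((dsort e).symm ij.1) ((dsort e).symm ij.1) := by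
        have : ij = (ij.1, ij.1) := Prod.ext rfl heq.symm
        rw [this]; exact pos_diag e ij.1
      have := Icc_inj hij'.le (hij.2.symm.trans h1)
      rw [this.1, this.2] at hij'
      exact absurd hij' (lt_irrefl _)
    · obtain ⟨z, j'', hz, -, h⟩ :=
        pos_kern_eq_Icc hN (Finset.mem_filter.mpr ⟨Finset.mem_univ _, hlt, hij1.2⟩)
      have := Icc_inj hij'.le (hij.2.symm.trans h)
      rw [this.1, hz]
  · ext w
    rw [hs', KZ.IntegralRep.reindex_domain, mem_setOf_eq, hs]
    constructor
    · intro h i; simpa using h (dsort e i)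
    · intro h i; exact h _
  · -- the relabelled integrand is the pushed-forward atom
    have hw' : (fun i => w ((dsort e).symm i)) ∈ s.domain := by
      rw [hs', KZ.IntegralRep.reindex_domain] at hw; exact hw
    have h2 : ∀ i, w ((dsort e).symm i) ∈ Ioo (0:ℝ) 1 := by rw [hs] at hw'; exact hw'
    have hwc : w ∈ ocube k := fun i => by simpa using h2 (dsort e i)
    rw [hs', KZ.IntegralRep.reindex_integrand]
    change s.integrand (fun i => w ((dsort e).symm i)) = atomQ k q (fun m => a (dsort e m)) e' w
    rw [hi hw']
    simp only [atomQ]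
    congr 2
    · -- the monomial
      exact (Equiv.prod_comp (dsort e) (fun l => w ((dsort e).symm l) ^ a l)).symm.trans
        (Finset.prod_congr rfl fun m _ => by simp)
    · -- the chords
      simp_rw [cp_comp_dsort_symm]
      rw [he', ← prod_chord_pushforward src (pos e) (fun ij => e ij.1 ij.2) hS hwc,
        ← Fintype.prod_prod_type', ← Finset.prod_filter]
      -- drop the inactive chords
      rw [← Finset.prod_filter_mul_prod_filter_not _ (fun ij : Fin k × Fin k => e ij.1 ij.2 ≠ 0)]
      rw [Finset.filter_filter, Finset.filter_filter]
      have h1 : ∏ ij ∈ Finset.univ.filter (fun ij : Fin k × Fin k => ij.1 ≤ ij.2 ∧ ¬ e ij.1 ij.2 ≠ 0),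
          (1 - ∏ m ∈ pos e (ij.1, ij.2), w m) ^ e ij.1 ij.2 = 1 :=
        Finset.prod_eq_one fun ij hij => by
          simp only [Finset.mem_filter, Finset.mem_univ, true_and, not_not] at hij
          rw [hij.2, zpow_zero]
      rw [h1, mul_one]

end Nested

/-- **Registered sub-goal `stub_nestedReductionAux16`**: a nested cubical atom is a prefix-nested atom after one change-of-variables move (coordinates sorted by depth, `Nested.exists_prefix_reindex`). -/
theorem stub_nestedReductionAux16 : ∀ (k : ℕ) (q : ℚ) (a : Fin k → ℕ) (e : Fin k → Fin k → ℤ), (∀ i j i' j' : Fin k, i < j → i' < j' → e i j ≠ 0 → e i' j' ≠ 0 → (i ≤ i' ∧ j' ≤ j) ∨ (i' ≤ i ∧ j ≤ j')) → ∀ (s : Literature.NumberTheory.Transcendental.KZ.IntegralRep k), s.domain = {x : Fin k → ℝ | ∀ i, x i ∈ Set.Ioo (0:ℝ) 1} → Set.EqOn s.integrand (fun x => (q : ℝ) * ((∏ i : Fin k, x i ^ a i) * ∏ i : Fin k, ∏ j : Fin k, if i ≤ j then (1 - (∏ l : Fin k, if i ≤ l ∧ l ≤ j then x l else 1)) ^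 e i j else 1)) s.domain → ∃ (a' : Fin k → ℕ) (e' : Fin k → Fin k → ℤ) (s' : Literature.NumberTheory.Transcendental.KZ.IntegralRep k), (∀ i j : Fin k, i < j → e' i j ≠ 0 → (i : ℕ) = 0) ∧ s'.domain = {x : Fin k → ℝ | ∀ i, x i ∈ Set.Ioo (0:ℝ) 1} ∧ Set.EqOn s'.integrand (fun x => (q : ℝ) * ((∏ i : Fin k, x i ^ a' i) * ∏ i : Fin k, ∏ j : Fin k, if i ≤ j then (1 - (∏ l : Fin k, if i ≤ l ∧ l ≤ j then x l else 1)) ^ e' i j else 1)) s'.domain ∧ Literature.NumberTheory.Transcendental.KZ.of s - Literature.NumberTheory.Transcendental.KZ.of s' ∈ Literature.NumberTheory.Transcendental.KZ.relations :=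
  fun _ q a e hN s hs hi =>
    Nested.exists_prefix_reindex q a e hN s hs hi

end Summit.KontsevichZagierPeriods.DihedralNormalForm.TorusDescent
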